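import Literature.Probability.FitznerVanDerHofstad2017.NobleKSpaceRewriteFRem
import HarnessLib

/-!
# (D.13): the `ℓ¹` bound `Σ_x |R_F(x)| ≤ β_{R,F}` of the extended simplified form — proof

[NoBLE17] = Fitzner–van der Hofstad, *Generalized approach to the non-backtracking lace expansion*,
PTRF 169 (2017), App. D Step 2, (D.10)–(D.13) (pp. 1111–1113).

`NoblePhiRemWeighted.nobleSimplifiedFormF3At_of_assumptions₆` assembles the extended simplified rewrite
from Assumptions 4.1–4.3 with two NAMED ANALYTIC HYPOTHESES, (D.13) `hD13 : Σ_x |R_F(x)| ≤ β_{R,F}(i)` and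
(D.29), on the constructed remainder `nobleFRem S` of `NobleKSpaceRewriteFRem`.  This module PROVES the display
(D.13), d-generically, by the bookkeeping of [NoBLE17] App. D Step 2 ("Using these bounds, we obtain that
`R_F` (defined in (D.10)) is bounded by …", p. 1113):

* `R_F = Σ_ι R^F_ι` (`nobleFRem_eq_sum_dirRem`, needs `F^α` totally rotationally symmetric) with the six terms
  `R^F_ι = T1 + ⋯ + T6` of `NobleKSpaceRewriteFRem` ((D.10) expanded with `s_ι = u_ι − (Au)_ι + T²_ι`,
  `Ψ^ι = Ψ^{(0),ι} − Ψ^{(1),ι} + Ψ^ι_{≥2}`, `Π^{ι,κ} = Π^{(0),ι,κ} − Π^{ι,κ}_{≥1}` and the `α/R` splits);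
* each term is put in `ℓ¹(ℤ^d)` with an explicit mass bound (`nobleFDirRem_l1`): `‖f ⋆ g‖₁ ≤ ‖f‖₁‖g‖₁`,
  `‖(A t)_ι‖₁ ≤ (Σ_κ ‖A^{ι,κ}‖₁) max_κ ‖t_κ‖₁`, the geometric Neumann sum (D.8) for `T²_ι = Σ_{n≥2}(−1)ⁿ(Aⁿu)_ι`
  (ratio `θ = (2d−1) μ̄_p β_{Ξ^ι}/(1−μ_p)`, the `(2d−1)` being the non-backtracking count of the `κ`-summed
  relation (4.29), a tree theorem below `p_c`: `NobleRelationSummedAt`), and the aggregate bounds (4.49) of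
  Assumption 4.3 for the classes `Ψ^{[N≥2]}`, `Π^{[N≥1],ι,·}` and the remainders `Ψ_{R,I/II}^{(0/1)}`, `Π_R^{(0)}`;
* summing over the `2d` directions with `Σ_ι ‖Ψ^ι‖₁ ≤ (2d−1)(μ̄_p/μ_p) β_Ξ` (`noble_sum_psi_l1`) gives the explicit
  constant `nobleFRemBound` (`nobleFRem_l1`), and the monotone substitution `μ_p ≤ μ`, `μ̄_p ≤ μ̄`,
  `μ̄_p ≤ β_{μ̄/μ} μ_p` of App. D Step 1 bounds it by the closed form `BetaMap.betaRFSq` (`nobleFRemBound_le_betaRFSq`).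

## The constant, the notebook's `betaRF`, and one side condition (recorded, not silently repaired)

`BetaMap.betaRFSq` is the notebook function `betaRF` of `General.nb` (lines 61–67; the tree's generated
`BetaMap.betaRF`, fed by `extraOfInputs · · 2` with `PsiToXi = (2d−1)/(2d)·β_{μ̄/μ}`, `muPiToXii = (2d−1)/(2d)·μ̄`)
with ONE coefficient changed: the last term of the fourth line is `(2d)²·muPiToXii²/(1−μ)²·β_Ξ β_{Ξ^ι}` — the
printed `(2d)² μ̄²/(1−μ)² β_Ξ β_{Ξ^ι}` of (D.13) evaluated at the rescaled `μ̄ ↦ muPiToXii` which the notebook uses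
in every other `Π`-factor — where the notebook has `(2d)²·muPiToXii·mu/(1−μ)²·β_Ξ β_{Ξ^ι}` (one `μ̄` replaced by
`μ`; cf. the catalogued print-vs-notebook readings of this term).  The bookkeeping proves the term with the
constant `(2d−1)² μ̄_p² β_Ξ β_{Ξ^ι}/(1−μ_p)² ≤ (2d)² muPiToXii² (…)`: one factor `(2d−1)μ̄_p` from the row sums of
`A` in `‖(Au)_ι‖₁`, one from `μ_p Σ_ι ‖Ψ^ι‖₁ ≤ (2d−1) μ̄_p β_Ξ`.  Hence (`betaRF_sub_betaRFSq`, a `ring` identity)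
`betaRF − betaRFSq = (2d)² muPiToXii (mu − muPiToXii)/(1−mu)² · β_Ξ β_{Ξ^ι}`, which is `≥ 0` exactly when
`(2d−1)/(2d)·μ̄ ≤ μ`.  So:

* `nobleFRem_l1_le_betaRFSq` — (D.13) with the constant `betaRFSq(i)`, NO side condition;
* `nobleFRem_l1_le_extraOfInputs` — (D.13) AS WIRED (`BetaMap.extraOfInputs d i 2 = betaRF(…)`) under the
  decidable side condition `hcapQ : (2d−1)·i.mub ≤ 2d·i.mu` on the record;
* the assembly with (D.13) discharged (`nobleSimplifiedFormF3At_of_assumptions₇` / `…_percolation₇`, whose only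
  remaining named analytic hypothesis is (D.29)) is the two-line corollary recorded in the follow-up module
  `NobleSimplifiedFormF3D13` (it needs `NoblePhiRemWeighted`, which this module does not import).

Additive module: nothing in `BetaMap.lean` (generated), `NobleKSpaceRewriteFRem` or the assembly modules is modified.
-/

namespace Literature.Probability.FitznerVanDerHofstad2017

open scoped BigOperators
open Literature.Probability.LatticeModels
open Literature.Probability.Percolation
open Literature.Barriers.CriticalPhenomena

variable {d : ℕ}

/-! ## Part A. The closed-form constant `betaRFSq` and its comparison with the wired `betaRF` -/

namespace BetaMap

/-- `General.nb`'s `betaRF[d, mu, mubar, PsiToXi, muPiToXii, XiAbs, XigeqTwoAbs, XiIotaAbs, XiIotageqOneAbs, PsiRI,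
PsiRII, PiR]` ((D.13)) with the last coefficient of the fourth line `(2d)²·muPiToXii²` (printed `(2dμ̄)²`) in place
of the notebook's `(2d)²·muPiToXii·mu`; all other lines verbatim.
[cite: FitznerVanDerHofstad2016NoBLE, App. D (D.13) (p. 1113)] -/
noncomputable def betaRFSq (d mu mubar PsiToXi muPiToXii XiAbs XigeqTwoAbs XiIotaAbs XiIotageqOneAbs PsiRI PsiRII PiR : ℝ) : ℝ :=
  let tmp1 := (2*d*muPiToXii)/(1-mu)*XiIotaAbs
  let firstLine := (2*d*mu)/(1-mu)*(1+PsiToXi*XiAbs)/(1-tmp1)*tmp1^2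
  let secondLine := (2*d)/(1-mu^2)*(mu*PsiRI + mu^2*PsiRII + mubar*(1+mu)*XigeqTwoAbs)
  let thirdLine := (2*d*mu)/((1-mu^2)^2)*(PiR + 2*d*muPiToXii*XiIotageqOneAbs)
  let fourthLine := ((2*d)^2*mu*muPiToXii)/((1-mu^2)^2)*(2+mu)*XiIotaAbs + ((2*d)^2*muPiToXii^2)/((1-mu)^2)*XiAbs*XiIotaAbs
  firstLine + secondLine + thirdLine + fourthLine

/-- **Notebook minus bookkeeping constant**: `betaRF − betaRFSq = (2d)² muPiToXii (mu − muPiToXii)/(1−mu)² · β_Ξ β_{Ξ^ι}`.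
[cite: FitznerVanDerHofstad2016NoBLE, App. D (D.13) (p. 1113)] -/
theorem betaRF_sub_betaRFSq (d mu mubar PsiToXi muPiToXii XiAbs XigeqTwoAbs XiIotaAbs XiIotageqOneAbs PsiRI PsiRII PiR : ℝ) :
    betaRF d mu mubar PsiToXi muPiToXii XiAbs XigeqTwoAbs XiIotaAbs XiIotageqOneAbs PsiRI PsiRII PiR -
      betaRFSq d mu mubar PsiToXi muPiToXii XiAbs XigeqTwoAbs XiIotaAbs XiIotageqOneAbs PsiRI PsiRII PiR =
      (2 * d) ^ 2 * muPiToXii / (1 - mu) ^ 2 * (mu - muPiToXii) * XiAbs * XiIotaAbs := by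
  simp only [betaRF, betaRFSq]
  ring

/-- `betaRFSq ≤ betaRF` as soon as `muPiToXii ≤ mu` (with the sign conditions of Assumption 4.3).
[cite: FitznerVanDerHofstad2016NoBLE, App. D (D.13) (p. 1113)] -/
theorem betaRFSq_le_betaRF {d mu mubar PsiToXi muPiToXii XiAbs XigeqTwoAbs XiIotaAbs XiIotageqOneAbs PsiRI PsiRII PiR : ℝ}
    (h : muPiToXii ≤ mu) (h0 : 0 ≤ muPiToXii) (hX : 0 ≤ XiAbs) (hXI : 0 ≤ XiIotaAbs) :
    betaRFSq d mu mubar PsiToXi muPiToXii XiAbs XigeqTwoAbs XiIotaAbs XiIotageqOneAbs PsiRI PsiRII PiR ≤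
      betaRF d mu mubar PsiToXi muPiToXii XiAbs XigeqTwoAbs XiIotaAbs XiIotageqOneAbs PsiRI PsiRII PiR := by
  have e := betaRF_sub_betaRFSq d mu mubar PsiToXi muPiToXii XiAbs XigeqTwoAbs XiIotaAbs XiIotageqOneAbs PsiRI PsiRII PiR
  have h1 : 0 ≤ (2 * d) ^ 2 * muPiToXii / (1 - mu) ^ 2 * (mu - muPiToXii) * XiAbs * XiIotaAbs :=
    mul_nonneg (mul_nonneg (mul_nonneg (div_nonneg (mul_nonneg (sq_nonneg _) h0) (sq_nonneg _))
      (sub_nonneg.2 h)) hX) hXI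
  linarith

/-- Component `2` of the wired table is `betaRF(…)` (unfolding). [folklore] -/
theorem extraOfInputs_two (d : ℝ) (i : Inputs) :
    extraOfInputs d i 2 = betaRF d (i.mu) (i.mub) ((2*d-1)/(2*d)*i.mubOverMu) ((2*d-1)/(2*d)*i.mub) (i.xiAbs)
      (i.xiEvenTail + i.xiOddTail) (i.xiIotaAbs) (i.xiIotaOdd + i.xiIotaEvenTail) (i.psiRI0 + i.psiRI1)
      (i.psiRII0 + i.psiRII1) (i.piR0) := rfl

end BetaMap

/-! ## Part B. The monotone substitution of App. D Step 1 for the explicit `ℓ¹` constant -/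

section Scalar

/-- **The explicit `ℓ¹` constant is at most `betaRFSq`** under `0 ≤ μ ≤ m < 1`, `0 ≤ μ̄_p ≤ μ̄`, `μ̄_p ≤ β_{μ̄/μ} μ`
and the geometric condition `(2d−1) μ̄ β_{Ξ^ι}/(1−m) < 1` (term by term; every factor is non-negative and
non-decreasing in the substituted scalars). [cite: FitznerVanDerHofstad2016NoBLE, App. D Step 1 ("we extract the p-dependence using μ_p ≤ μ̄_p") and (D.13) (pp. 1110–1113)] -/
theorem betaRFSq_ge_explicit {dd μ m pr mo mub xiAbs X2 RI RII piR XI XI1 : ℝ} (hdd : 1 ≤ dd)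
    (hμ0 : 0 ≤ μ) (hμm : μ ≤ m) (hm1 : m < 1) (hq0 : 0 ≤ pr) (hqm : pr ≤ mub) (hmo : 0 ≤ mo) (hqo : pr ≤ mo * μ)
    (hxi : 0 ≤ xiAbs) (hX2 : 0 ≤ X2) (hRI : 0 ≤ RI) (hRII : 0 ≤ RII) (hpiR : 0 ≤ piR) (hXI : 0 ≤ XI)
    (hXI1 : 0 ≤ XI1) (htmp : (2 * dd - 1) * mub * XI / (1 - m) < 1) :
    μ * (2 * dd + (2 * dd - 1) * (pr / μ) * xiAbs) *
        ((2 * dd - 1) * pr * XI / (1 - μ) * ((2 * dd - 1) * pr * XI / (1 - μ) * ((1 - μ ^ 2)⁻¹ * (1 + μ))) /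
          (1 - (2 * dd - 1) * pr * XI / (1 - μ))) +
      2 * dd * (μ * (1 - μ ^ 2)⁻¹ * (1 + μ) * (pr / μ * X2)) +
      2 * dd * (μ * (1 - μ ^ 2)⁻¹ * (RI + μ * RII)) +
      μ * ((1 - μ ^ 2)⁻¹) ^ 2 * (2 * dd * piR + 2 * dd * ((2 * dd - 1) * pr * XI1)) +
      2 * dd * (μ ^ 2 * ((1 - μ ^ 2)⁻¹) ^ 2 * ((2 + μ) * ((2 * dd - 1) * pr * XI))) +
      μ * ((2 * dd - 1) * (pr / μ) * xiAbs) * ((2 * dd - 1) * pr * XI / (1 - μ) * ((1 - μ ^ 2)⁻¹ * (1 + μ)))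
    ≤ BetaMap.betaRFSq dd m mub ((2 * dd - 1) / (2 * dd) * mo) ((2 * dd - 1) / (2 * dd) * mub) xiAbs X2 XI XI1
        RI RII piR := by
  have hm0 : 0 ≤ m := hμ0.trans hμm
  have hμ1 : μ < 1 := hμm.trans_lt hm1
  have h1m : 0 < 1 - m := by linarith
  have h1μ : 0 < 1 - μ := by linarith
  have h1pμ : 0 < 1 + μ := by linarith
  have h1pm : 0 < 1 + m := by linarith
  have hmsq : m ^ 2 ≤ m := by rw [sq]; exact mul_le_of_le_one_right hm0 hm1.le
  have hμsq : μ ^ 2 ≤ μ := by rw [sq]; exact mul_le_of_le_one_right hμ0 hμ1.le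
  have h1m2 : 0 < 1 - m ^ 2 := by linarith
  have h1μ2 : 0 < 1 - μ ^ 2 := by linarith
  have h1μ' : (1 - μ) ≠ 0 := h1μ.ne'
  have h1μ2' : (1 - μ ^ 2) ≠ 0 := h1μ2.ne'
  have h1m' : (1 - m) ≠ 0 := h1m.ne'
  have h1m2' : (1 - m ^ 2) ≠ 0 := h1m2.ne'
  have h1pμ' : (1 + μ) ≠ 0 := h1pμ.ne'
  have h1pm' : (1 + m) ≠ 0 := h1pm.ne'
  have hdd0 : 0 < dd := by linarith
  have hdd2 : (0 : ℝ) ≤ 2 * dd := by linarith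
  have hdd' : (2 * dd) ≠ 0 := by positivity
  have h2d1 : 0 ≤ 2 * dd - 1 := by linarith
  have hmub0 : 0 ≤ mub := hq0.trans hqm
  -- the scalar comparisons `μ c ≤ m c_m`, `c ≤ c_m`, `1/(1−μ) ≤ 1/(1−m)`
  have hc := mu_div_one_sub_sq_mono hμ0 hμm hm1
  have hcm0 : 0 ≤ m / (1 - m ^ 2) := div_nonneg hm0 h1m2.le
  have hci0 : 0 ≤ (1 - μ ^ 2)⁻¹ := (inv_pos.2 h1μ2).le
  have hcmi0 : 0 ≤ (1 - m ^ 2)⁻¹ := (inv_pos.2 h1m2).le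
  have hcinv : (1 - μ ^ 2)⁻¹ ≤ (1 - m ^ 2)⁻¹ := by
    rw [inv_eq_one_div, inv_eq_one_div]
    exact one_div_le_one_div_of_le h1m2 (by linarith [mul_le_mul hμm hμm hμ0 hm0])
  have hcc : ((1 - μ ^ 2)⁻¹) ^ 2 ≤ ((1 - m ^ 2)⁻¹) ^ 2 := by
    rw [sq ((1 - μ ^ 2)⁻¹), sq ((1 - m ^ 2)⁻¹)]; exact mul_le_mul hcinv hcinv hci0 hcmi0
  have hU : (1 - μ ^ 2)⁻¹ * (1 + μ) = 1 / (1 - μ) := by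
    have : (1 : ℝ) - μ ^ 2 = (1 - μ) * (1 + μ) := by ring
    rw [this]
    field_simp
  have hinv1 : 1 / (1 - μ) ≤ 1 / (1 - m) := one_div_le_one_div_of_le h1m (by linarith)
  have hinv0 : 0 ≤ 1 / (1 - μ) := (one_div_pos.2 h1μ).le
  have hinvm0 : 0 ≤ 1 / (1 - m) := (one_div_pos.2 h1m).le
  -- θ ≤ t1 < 1
  set θ := (2 * dd - 1) * pr * XI / (1 - μ) with hθ
  set t1 := (2 * dd - 1) * mub * XI / (1 - m) with ht1
  have hθ0 : 0 ≤ θ := div_nonneg (mul_nonneg (mul_nonneg h2d1 hq0) hXI) h1μ.le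
  have ht10 : 0 ≤ t1 := div_nonneg (mul_nonneg (mul_nonneg h2d1 hmub0) hXI) h1m.le
  have hθt : θ ≤ t1 := by
    rw [hθ, ht1, div_le_div_iff₀ h1μ h1m]
    have e1 : (2 * dd - 1) * pr * XI ≤ (2 * dd - 1) * mub * XI :=
      mul_le_mul_of_nonneg_right (mul_le_mul_of_nonneg_left hqm h2d1) hXI
    have e0 : 0 ≤ (2 * dd - 1) * mub * XI := mul_nonneg (mul_nonneg h2d1 hmub0) hXI
    calc (2 * dd - 1) * pr * XI * (1 - m) ≤ (2 * dd - 1) * mub * XI * (1 - m) :=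
          mul_le_mul_of_nonneg_right e1 h1m.le
      _ ≤ (2 * dd - 1) * mub * XI * (1 - μ) := mul_le_mul_of_nonneg_left (by linarith) e0
  have hθ1 : θ < 1 := hθt.trans_lt htmp
  have h1t : (1 - t1) ≠ 0 := by linarith
  have hfrac : θ / (1 - θ) ≤ t1 / (1 - t1) := by
    have e1 : 0 < 1 - θ := by linarith
    have e2 : 0 < 1 - t1 := by linarith
    rw [div_le_div_iff₀ e1 e2]
    nlinarith [hθt]
  have hfrac0 : 0 ≤ θ / (1 - θ) := div_nonneg hθ0 (by linarith)
  have hfrac2 : θ * (θ / (1 - θ)) ≤ t1 * (t1 / (1 - t1)) := mul_le_mul hθt hfrac hfrac0 ht10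
  have hfrac20 : 0 ≤ θ * (θ / (1 - θ)) := mul_nonneg hθ0 hfrac0
  -- μ (μ̄_p/μ) ≤ μ̄_p ≤ β_{μ̄/μ} m
  have hμq : μ * (pr / μ) ≤ pr := by
    rcases eq_or_lt_of_le hμ0 with h | h
    · rw [← h]; simp [hq0]
    · rw [mul_div_cancel₀ _ h.ne']
  have hμq0 : 0 ≤ μ * (pr / μ) := mul_nonneg hμ0 (div_nonneg hq0 hμ0)
  have hA : μ * (pr / μ) ≤ mo * m := hμq.trans (hqo.trans (mul_le_mul_of_nonneg_left hμm hmo))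
  -- normalise both sides
  rw [hU]
  simp only [BetaMap.betaRFSq]
  have htmp1 : 2 * dd * ((2 * dd - 1) / (2 * dd) * mub) / (1 - m) * XI = t1 := by
    rw [ht1]; field_simp
  rw [htmp1]
  -- piece 1 : the Neumann tail `T²` (first line)
  have p1 : μ * (2 * dd + (2 * dd - 1) * (pr / μ) * xiAbs) * (θ * (θ * (1 / (1 - μ))) / (1 - θ)) ≤
      2 * dd * m / (1 - m) * (1 + (2 * dd - 1) / (2 * dd) * mo * xiAbs) / (1 - t1) * t1 ^ 2 := by
    have lhs_eq : μ * (2 * dd + (2 * dd - 1) * (pr / μ) * xiAbs) * (θ * (θ * (1 / (1 - μ))) / (1 - θ)) =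
        (2 * dd * μ + (2 * dd - 1) * (μ * (pr / μ)) * xiAbs) * (1 / (1 - μ)) * (θ * (θ / (1 - θ))) := by ring
    have rhs_eq : 2 * dd * m / (1 - m) * (1 + (2 * dd - 1) / (2 * dd) * mo * xiAbs) / (1 - t1) * t1 ^ 2 =
        (2 * dd * m + (2 * dd - 1) * (mo * m) * xiAbs) * (1 / (1 - m)) * (t1 * (t1 / (1 - t1))) := by
      field_simp
    rw [lhs_eq, rhs_eq]
    have hF1 : 2 * dd * μ + (2 * dd - 1) * (μ * (pr / μ)) * xiAbs ≤ 2 * dd * m + (2 * dd - 1) * (mo * m) * xiAbs := by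
      have e1 := mul_le_mul_of_nonneg_right (mul_le_mul_of_nonneg_left hA h2d1) hxi
      have e2 := mul_le_mul_of_nonneg_left hμm hdd2
      linarith
    have hF2_0 : 0 ≤ 2 * dd * m + (2 * dd - 1) * (mo * m) * xiAbs :=
      add_nonneg (mul_nonneg hdd2 hm0) (mul_nonneg (mul_nonneg h2d1 (mul_nonneg hmo hm0)) hxi)
    exact mul_le_mul (mul_le_mul hF1 hinv1 hinv0 hF2_0) hfrac2 hfrac20 (mul_nonneg hF2_0 hinvm0)
  -- piece 2 : `Ψ_{≥2}` and the `Ψ`-remainders (second line)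
  have p2 : 2 * dd * (μ * (1 - μ ^ 2)⁻¹ * (1 + μ) * (pr / μ * X2)) + 2 * dd * (μ * (1 - μ ^ 2)⁻¹ * (RI + μ * RII)) ≤
      2 * dd / (1 - m ^ 2) * (m * RI + m ^ 2 * RII + mub * (1 + m) * X2) := by
    have e2 : μ * (1 - μ ^ 2)⁻¹ * (1 + μ) * (pr / μ * X2) = μ * (pr / μ) * (1 / (1 - μ)) * X2 := by
      rw [← hU]; ring
    have rhs_eq : 2 * dd / (1 - m ^ 2) * (m * RI + m ^ 2 * RII + mub * (1 + m) * X2) =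
        2 * dd * (m / (1 - m ^ 2) * (RI + m * RII)) + 2 * dd * (mub * (1 / (1 - m)) * X2) := by
      have h4 : (1 : ℝ) - m ^ 2 = (1 - m) * (1 + m) := by ring
      rw [h4]
      field_simp
    rw [e2, rhs_eq]
    have i2 : μ * (pr / μ) * (1 / (1 - μ)) * X2 ≤ mub * (1 / (1 - m)) * X2 :=
      mul_le_mul_of_nonneg_right (mul_le_mul (hμq.trans hqm) hinv1 hinv0 hmub0) hX2
    have i3 : μ * (1 - μ ^ 2)⁻¹ * (RI + μ * RII) ≤ m / (1 - m ^ 2) * (RI + m * RII) :=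
      mul_le_mul hc (add_le_add le_rfl (mul_le_mul_of_nonneg_right hμm hRII))
        (add_nonneg hRI (mul_nonneg hμ0 hRII)) hcm0
    have e3 := mul_le_mul_of_nonneg_left i2 hdd2
    have e4 := mul_le_mul_of_nonneg_left i3 hdd2
    linarith
  -- piece 3 : `Π_R^{(0)}` and `Π_{≥1}` (third line)
  have p3 : μ * ((1 - μ ^ 2)⁻¹) ^ 2 * (2 * dd * piR + 2 * dd * ((2 * dd - 1) * pr * XI1)) ≤
      2 * dd * m / (1 - m ^ 2) ^ 2 * (piR + 2 * dd * ((2 * dd - 1) / (2 * dd) * mub) * XI1) := by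
    have rhs_eq : 2 * dd * m / (1 - m ^ 2) ^ 2 * (piR + 2 * dd * ((2 * dd - 1) / (2 * dd) * mub) * XI1) =
        m * ((1 - m ^ 2)⁻¹) ^ 2 * (2 * dd * piR + 2 * dd * ((2 * dd - 1) * mub * XI1)) := by
      field_simp
    rw [rhs_eq]
    have i1 : μ * ((1 - μ ^ 2)⁻¹) ^ 2 ≤ m * ((1 - m ^ 2)⁻¹) ^ 2 := mul_le_mul hμm hcc (sq_nonneg _) hm0
    have i2 : 2 * dd * piR + 2 * dd * ((2 * dd - 1) * pr * XI1) ≤ 2 * dd * piR + 2 * dd * ((2 * dd - 1) * mub * XI1) := by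
      have e1 := mul_le_mul_of_nonneg_left
        (mul_le_mul_of_nonneg_right (mul_le_mul_of_nonneg_left hqm h2d1) hXI1) hdd2
      linarith
    have i20 : 0 ≤ 2 * dd * piR + 2 * dd * ((2 * dd - 1) * pr * XI1) :=
      add_nonneg (mul_nonneg hdd2 hpiR) (mul_nonneg hdd2 (mul_nonneg (mul_nonneg h2d1 hq0) hXI1))
    exact mul_le_mul i1 i2 i20 (mul_nonneg hm0 (sq_nonneg _))
  -- piece 4a : the three `μ`-weighted `Π`-terms of `(Au)_ι` (fourth line, first term)
  have p4a : 2 * dd * (μ ^ 2 * ((1 - μ ^ 2)⁻¹) ^ 2 * ((2 + μ) * ((2 * dd - 1) * pr * XI))) ≤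
      (2 * dd) ^ 2 * m * ((2 * dd - 1) / (2 * dd) * mub) / (1 - m ^ 2) ^ 2 * (2 + m) * XI := by
    have rhs_eq : (2 * dd) ^ 2 * m * ((2 * dd - 1) / (2 * dd) * mub) / (1 - m ^ 2) ^ 2 * (2 + m) * XI =
        2 * dd * (m * ((1 - m ^ 2)⁻¹) ^ 2 * ((2 + m) * ((2 * dd - 1) * mub * XI))) := by
      field_simp
    rw [rhs_eq]
    have i1 : μ ^ 2 * ((1 - μ ^ 2)⁻¹) ^ 2 ≤ m * ((1 - m ^ 2)⁻¹) ^ 2 :=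
      mul_le_mul (hμsq.trans hμm) hcc (sq_nonneg _) hm0
    have i2 : (2 + μ) * ((2 * dd - 1) * pr * XI) ≤ (2 + m) * ((2 * dd - 1) * mub * XI) :=
      mul_le_mul (by linarith) (mul_le_mul_of_nonneg_right (mul_le_mul_of_nonneg_left hqm h2d1) hXI)
        (mul_nonneg (mul_nonneg h2d1 hq0) hXI) (by linarith)
    have i20 : 0 ≤ (2 + μ) * ((2 * dd - 1) * pr * XI) :=
      mul_nonneg (by linarith) (mul_nonneg (mul_nonneg h2d1 hq0) hXI)
    exact mul_le_mul_of_nonneg_left (mul_le_mul i1 i2 i20 (mul_nonneg hm0 (sq_nonneg _))) hdd2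
  -- piece 4b : the cross term `Ψ^ι ⋆ (Au)_ι` (fourth line, second term)
  have p4b : μ * ((2 * dd - 1) * (pr / μ) * xiAbs) * (θ * (1 / (1 - μ))) ≤
      (2 * dd) ^ 2 * ((2 * dd - 1) / (2 * dd) * mub) ^ 2 / (1 - m) ^ 2 * xiAbs * XI := by
    have lhs_eq : μ * ((2 * dd - 1) * (pr / μ) * xiAbs) * (θ * (1 / (1 - μ))) =
        (2 * dd - 1) * (μ * (pr / μ)) * ((2 * dd - 1) * pr) * (xiAbs * XI) * (1 / (1 - μ)) ^ 2 := by
      rw [hθ]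
      ring
    have rhs_eq : (2 * dd) ^ 2 * ((2 * dd - 1) / (2 * dd) * mub) ^ 2 / (1 - m) ^ 2 * xiAbs * XI =
        (2 * dd - 1) * mub * ((2 * dd - 1) * mub) * (xiAbs * XI) * (1 / (1 - m)) ^ 2 := by
      field_simp
    rw [lhs_eq, rhs_eq]
    have i1 : (2 * dd - 1) * (μ * (pr / μ)) ≤ (2 * dd - 1) * mub := mul_le_mul_of_nonneg_left (hμq.trans hqm) h2d1
    have i2 : (2 * dd - 1) * pr ≤ (2 * dd - 1) * mub := mul_le_mul_of_nonneg_left hqm h2d1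
    have i3 : (1 / (1 - μ)) ^ 2 ≤ (1 / (1 - m)) ^ 2 := by
      rw [sq (1 / (1 - μ)), sq (1 / (1 - m))]; exact mul_le_mul hinv1 hinv1 hinv0 hinvm0
    have n1 : 0 ≤ (2 * dd - 1) * mub := mul_nonneg h2d1 hmub0
    have i12 : (2 * dd - 1) * (μ * (pr / μ)) * ((2 * dd - 1) * pr) ≤ (2 * dd - 1) * mub * ((2 * dd - 1) * mub) :=
      mul_le_mul i1 i2 (mul_nonneg h2d1 hq0) n1
    exact mul_le_mul (mul_le_mul_of_nonneg_right i12 (mul_nonneg hxi hXI)) i3 (sq_nonneg _)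
      (mul_nonneg (mul_nonneg n1 n1) (mul_nonneg hxi hXI))
  linarith

end Scalar

/-! ## Part C. The classes `Ψ^{[·]}`, `Π^{[·]}` and the remainders of Assumption 4.3 in `ℓ¹` -/

section ClassesL1

local notation "𝐞" => Literature.Probability.Percolation.stepVec

variable {p : unitInterval} {P X : ℝ} {i : BetaMap.Inputs} {S : NobleSplit d p}

/-- `Σ_x |f(x + v + w)| = Σ_x |f x|`. [folklore] -/
theorem tsum_abs_comp_add_right₂ (f : Site d → ℝ) (v w : Site d) : ∑' x, |f (x + v + w)| = ∑' x, |f x| :=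
  (tsum_abs_comp_add_right (fun y => f (y + w)) v).trans (tsum_abs_comp_add_right f w)

/-- `x ↦ |f(x + v + w)|` is summable for `f ∈ ℓ¹`. [folklore] -/
theorem summable_abs_comp_add_right₂ {f : Site d → ℝ} (hf : Summable fun x => |f x|) (v w : Site d) :
    Summable fun x => |f (x + v + w)| :=
  summable_abs_comp_add_right (a := fun y => f (y + w)) (summable_abs_comp_add_right hf w) v

/-- `Ψ^{(N),ι}_{R,I} ∈ ℓ¹` (`N = 0,1`) with `Σ_x |Ψ^{(N),ι}_{R,I}(x)| ≤ β^{(N)}_{Ψ,R,I}`. [cite: FitznerVanDerHofstad2016NoBLE, Assumption 4.3 (4.44) (p. 1087)] -/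
theorem psiRI_l1 (h43 : NobleAssumption43At d p S i) (ι : Fin d × Bool) :
    (Summable fun x => |S.psiRI 0 ι x|) ∧ ∑' x, |S.psiRI 0 ι x| ≤ i.psiRI0 ∧
      (Summable fun x => |S.psiRI 1 ι x|) ∧ ∑' x, |S.psiRI 1 ι x| ≤ i.psiRI1 := by
  obtain ⟨hs0, he0⟩ := summable_abs_of_nonneg' (S.psiRI_nonneg zero_le_one ι) (h43.psiRI0 ι).1
  obtain ⟨hs1, he1⟩ := summable_abs_of_nonneg' (S.psiRI_nonneg le_rfl ι) (h43.psiRI1 ι).1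
  exact ⟨hs0, he0 ▸ (h43.psiRI0 ι).2, hs1, he1 ▸ (h43.psiRI1 ι).2⟩

/-- `Ψ^{(N),ι}_{R,II} ∈ ℓ¹` (`N = 0,1`) with `Σ_x |Ψ^{(N),ι}_{R,II}(x)| ≤ β^{(N)}_{Ψ,R,II}`. [cite: FitznerVanDerHofstad2016NoBLE, Assumption 4.3 (4.45) (p. 1087)] -/
theorem psiRII_l1 (h43 : NobleAssumption43At d p S i) (ι : Fin d × Bool) :
    (Summable fun x => |S.psiRII 0 ι x|) ∧ ∑' x, |S.psiRII 0 ι x| ≤ i.psiRII0 ∧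
      (Summable fun x => |S.psiRII 1 ι x|) ∧ ∑' x, |S.psiRII 1 ι x| ≤ i.psiRII1 := by
  obtain ⟨hs0, he0⟩ := summable_abs_of_nonneg' (S.psiRII_nonneg zero_le_one ι) (h43.psiRII0 ι).1
  obtain ⟨hs1, he1⟩ := summable_abs_of_nonneg' (S.psiRII_nonneg le_rfl ι) (h43.psiRII1 ι).1
  exact ⟨hs0, he0 ▸ (h43.psiRII0 ι).2, hs1, he1 ▸ (h43.psiRII1 ι).2⟩

/-- `Π^{(0),ι,κ}_R ∈ ℓ¹` and the COLUMN bound `Σ_ι Σ_x Π^{(0),ι,κ}_R(x) ≤ β^{(0)}_{Π,R}`. [cite: FitznerVanDerHofstad2016NoBLE, Assumption 4.3 (4.48) (p. 1087)] -/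
theorem piR_l1 (h43 : NobleAssumption43At d p S i) (κ : Fin d × Bool) :
    (∀ ι, Summable fun x => |S.piR ι κ x|) ∧ (∀ ι, ∑' x, |S.piR ι κ x| = ∑' x, S.piR ι κ x) ∧
      ∑ ι, ∑' x, S.piR ι κ x ≤ i.piR0 := by
  have h := fun ι => summable_abs_of_nonneg' (S.piR_nonneg ι κ) ((h43.piR0 κ).1 ι)
  exact ⟨fun ι => (h ι).1, fun ι => (h ι).2, (h43.piR0 κ).2⟩

variable (hd : 2 ≤ d) (hp : p < criticalProbI d)
include hd hp

/-- `Ψ^{[M],κ} ∈ ℓ¹` with `Σ_y Ψ^{[M],κ}(y) ≤ (μ̄_p/μ_p) β` from an `NSumLE` bound `β` for `Ξ^{(M_N)}` ((4.29), (4.49)).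
[cite: FitznerVanDerHofstad2016NoBLE, Assumption 4.2 (4.29) (p. 1086); Assumption 4.3 (4.49) (p. 1088)] -/
theorem psiCls_l1 {β : ℝ} {M : ℕ → ℕ} (hΞ : NSumLE (fun N x => nobleXiN d p (M N) x) β) (κ : Fin d × Bool) :
    (Summable fun y => |noblePsiCls d p M (𝐞 κ) y|) ∧
      ∑' y, |noblePsiCls d p M (𝐞 κ) y| ≤ (p : ℝ) / nobleMu d p * β := by
  have hK := l1_of_NSumLE (fun N x => noblePsiN_nonneg' p (𝐞 κ) (M N) x) (NSumLE_noblePsiN hd hp hΞ κ)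
  have h0 : ∀ y, 0 ≤ noblePsiCls d p M (𝐞 κ) y := fun y => noblePsiCls_nonneg _ _ _
  have hs : Summable fun y => noblePsiCls d p M (𝐞 κ) y := hK.2.1
  obtain ⟨hs', he⟩ := summable_abs_of_nonneg' h0 hs
  refine ⟨hs', ?_⟩
  rw [he]
  exact hK.2.2.2

/-- `Σ_κ Π^{[M],ι,κ} ∈ ℓ¹` with the NON-BACKTRACKING bound `Σ_κ Σ_y Π^{[M],ι,κ}(y) ≤ (2d−1) μ̄_p β` from an `NSumLE`
bound `β` for `Ξ^{(M_N),ι}` (the `κ`-summed relation, a tree theorem below `p_c`).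
[cite: FitznerVanDerHofstad2016NoBLE, Assumption 4.2 (4.29) (p. 1086); App. D (D.5), (D.11) (pp. 1111–1113)] -/
theorem sum_piCls_l1 (hRel : NobleRelationSummedAt d p) (ι : Fin d × Bool) {β : ℝ}
    {M : ℕ → ℕ} (hΞ : NSumLE (fun N x => nobleXiIotaN d p (𝐞 ι) (M N) x) β) :
    (∀ κ, Summable fun y => |noblePiCls d p M (𝐞 ι) (𝐞 κ) y|) ∧
      ∑ κ, ∑' y, |noblePiCls d p M (𝐞 ι) (𝐞 κ) y| ≤ (2 * d - 1) * (p : ℝ) * β := by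
  have hK := l1_of_NSumLE (fun N x => Finset.sum_nonneg fun κ _ => noblePiN_nonneg p (𝐞 ι) (𝐞 κ) (M N) x)
    (NSumLE_sum_noblePiN hd hRel ι hΞ)
  have hκ := fun κ => l1_of_NSumLE (fun N x => noblePiN_nonneg p (𝐞 ι) (𝐞 κ) (M N) x)
    (NSumLE_noblePiN hd hp ι hΞ κ)
  have h0 : ∀ κ y, 0 ≤ noblePiCls d p M (𝐞 ι) (𝐞 κ) y := fun κ y => noblePiCls_nonneg _ _ _ _
  have hs : ∀ κ, Summable fun y => noblePiCls d p M (𝐞 ι) (𝐞 κ) y := fun κ => (hκ κ).2.1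
  have hsa := fun κ => summable_abs_of_nonneg' (h0 κ) (hs κ)
  refine ⟨fun κ => (hsa κ).1, ?_⟩
  calc ∑ κ, ∑' y, |noblePiCls d p M (𝐞 ι) (𝐞 κ) y| = ∑ κ, ∑' y, ∑' N, noblePiN d p (𝐞 ι) (𝐞 κ) (M N) y :=
        Finset.sum_congr rfl fun κ _ => (hsa κ).2
    _ = ∑' y, ∑ κ, ∑' N, noblePiN d p (𝐞 ι) (𝐞 κ) (M N) y := (Summable.tsum_finsetSum fun κ _ => hs κ).symm
    _ = ∑' y, ∑' N, ∑ κ, noblePiN d p (𝐞 ι) (𝐞 κ) (M N) y :=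
        tsum_congr fun y => (Summable.tsum_finsetSum fun κ _ => (hκ κ).1 y).symm
    _ ≤ (2 * d - 1) * (p : ℝ) * β := hK.2.2.2

/-- `Ψ^ι_{≥2} := Ψ^{[even ≥2],ι} − Ψ^{[odd ≥3],ι} ∈ ℓ¹`, `Σ_y |Ψ^ι_{≥2}(y)| ≤ (μ̄_p/μ_p)(β_{Ξ,even tail} + β_{Ξ,odd tail})`.
[cite: FitznerVanDerHofstad2016NoBLE, App. D (D.13) (the term `(μ̄/μ)(1+μ) Σ_{N≥2} β_Ξ^{(N)}`) (p. 1113)] -/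
theorem noblePsiTail2_l1 (h43 : NobleAssumption43At d p S i) (ι : Fin d × Bool) :
    (Summable fun y => |noblePsiTail2 d p ι y|) ∧
      ∑' y, |noblePsiTail2 d p ι y| ≤ (p : ℝ) / nobleMu d p * (i.xiEvenTail + i.xiOddTail) := by
  obtain ⟨h2s, h2le⟩ := psiCls_l1 hd hp h43.xiEvenTail ι
  obtain ⟨h3s, h3le⟩ := psiCls_l1 hd hp h43.xiOddTail ι
  unfold noblePsiTail2
  refine ⟨summable_abs_sub' h2s h3s, (tsum_abs_sub_le' h2s h3s).trans ?_⟩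
  rw [mul_add]
  exact add_le_add h2le h3le

/-- `Π^{ι,κ}_{≥1} := Π^{[odd],ι,κ} − Π^{[even ≥2],ι,κ} ∈ ℓ¹` with the `κ`-summed bound
`Σ_κ Σ_y |Π^{ι,κ}_{≥1}(y)| ≤ (2d−1) μ̄_p (β_{Ξ^ι,odd} + β_{Ξ^ι,even tail})`.
[cite: FitznerVanDerHofstad2016NoBLE, App. D (D.13) (the term `2dμ̄ Σ_{N≥1} β_{Ξ^ι}^{(N)}`) (p. 1113)] -/
theorem sum_noblePiTail1_l1 (hp0 : 0 < (p : ℝ)) (h43 : NobleAssumption43At d p S i) (ι : Fin d × Bool) :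
    (∀ κ, Summable fun y => |noblePiTail1 d p ι κ y|) ∧
      ∑ κ, ∑' y, |noblePiTail1 d p ι κ y| ≤ (2 * d - 1) * (p : ℝ) * (i.xiIotaOdd + i.xiIotaEvenTail) := by
  have hRel := nobleRelationSummedAt_of_lt_criticalProbI hd hp0 hp
  obtain ⟨h1s, h1le⟩ := sum_piCls_l1 hd hp hRel ι (h43.xiIotaOdd ι)
  obtain ⟨h2s, h2le⟩ := sum_piCls_l1 hd hp hRel ι (h43.xiIotaEvenTail ι)
  refine ⟨fun κ => ?_, ?_⟩
  · unfold noblePiTail1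
    exact summable_abs_sub' (h1s κ) (h2s κ)
  · calc ∑ κ, ∑' y, |noblePiTail1 d p ι κ y|
        ≤ ∑ κ, ((∑' y, |noblePiCls d p (fun N => 2 * N + 1) (𝐞 ι) (𝐞 κ) y|) +
            ∑' y, |noblePiCls d p (fun N => 2 * N + 2) (𝐞 ι) (𝐞 κ) y|) :=
          Finset.sum_le_sum fun κ _ => by
            unfold noblePiTail1
            exact tsum_abs_sub_le' (h1s κ) (h2s κ)
      _ = (∑ κ, ∑' y, |noblePiCls d p (fun N => 2 * N + 1) (𝐞 ι) (𝐞 κ) y|) +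
            ∑ κ, ∑' y, |noblePiCls d p (fun N => 2 * N + 2) (𝐞 ι) (𝐞 κ) y| := Finset.sum_add_distrib
      _ ≤ (2 * d - 1) * (p : ℝ) * (i.xiIotaOdd + i.xiIotaEvenTail) := by rw [mul_add]; exact add_le_add h1le h2le

end ClassesL1

/-! ## Part D. The per-direction remainder `R^F_ι` and `R_F` in `ℓ¹` -/

section FL1

local notation "𝐞" => Literature.Probability.Percolation.stepVec

variable {p : unitInterval} {i : BetaMap.Inputs} {S : NobleSplit d p}

/-- The explicit `ℓ¹` bound on `R_F` in terms of `μ_p`, `μ̄_p = p` and the Assumption-4.3 constants (before the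
monotone replacement of App. D Step 1), with `c = (1−μ_p²)⁻¹`, `U₀ = c(1+μ_p) = ‖u_ι‖₁`,
`θ = (2d−1) μ̄_p β_{Ξ^ι}/(1−μ_p)` (row sums of `A`), `Ψ_S ≥ Σ_ι ‖Ψ^ι‖₁`: the six lines are the bounds of the six
terms `T1,…,T6` of `R^F_ι` summed over `ι`. [cite: FitznerVanDerHofstad2016NoBLE, App. D (D.10), (D.13) (pp. 1112–1113)] -/
noncomputable def nobleFRemBound (d : ℕ) (p : unitInterval) (i : BetaMap.Inputs) (ΨS : ℝ) : ℝ :=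
  nobleMu d p * (2 * d + ΨS) *
      ((2 * d - 1) * (p : ℝ) * i.xiIotaAbs / (1 - nobleMu d p) *
        ((2 * d - 1) * (p : ℝ) * i.xiIotaAbs / (1 - nobleMu d p) * ((1 - nobleMu d p ^ 2)⁻¹ * (1 + nobleMu d p))) /
        (1 - (2 * d - 1) * (p : ℝ) * i.xiIotaAbs / (1 - nobleMu d p))) +
    2 * d * (nobleMu d p * (1 - nobleMu d p ^ 2)⁻¹ * (1 + nobleMu d p) *
      ((p : ℝ) / nobleMu d p * (i.xiEvenTail + i.xiOddTail))) +
    2 * d * (nobleMu d p * (1 - nobleMu d p ^ 2)⁻¹ * ((i.psiRI0 + i.psiRI1) + nobleMu d p * (i.psiRII0 + i.psiRII1))) +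
    nobleMu d p * ((1 - nobleMu d p ^ 2)⁻¹) ^ 2 *
      (2 * d * i.piR0 + 2 * d * ((2 * d - 1) * (p : ℝ) * (i.xiIotaOdd + i.xiIotaEvenTail))) +
    2 * d * (nobleMu d p ^ 2 * ((1 - nobleMu d p ^ 2)⁻¹) ^ 2 *
      ((2 + nobleMu d p) * ((2 * d - 1) * (p : ℝ) * i.xiIotaAbs))) +
    nobleMu d p * ΨS *
      ((2 * d - 1) * (p : ℝ) * i.xiIotaAbs / (1 - nobleMu d p) * ((1 - nobleMu d p ^ 2)⁻¹ * (1 + nobleMu d p)))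

variable (hd : 2 ≤ d) (hp : p < criticalProbI d)
include hd hp

/-- **`T1` (the Neumann tail `μ(T²_ι + Ψ^ι ⋆ T²_ι)`) in `ℓ¹`**: mass `≤ μ(1+ψ₁^ι)·θ(θU₀)/(1−θ)`.
[cite: FitznerVanDerHofstad2016NoBLE, App. D (D.8), (D.13) (pp. 1112–1113)] -/
theorem nobleFRemT1_l1 [NeZero d] (hp0 : 0 < (p : ℝ)) (h43 : NobleAssumption43At d p S i) (ι : Fin d × Bool) :
    (Summable fun x => |nobleFRemT1 d p ι x|) ∧
      ∑' x, |nobleFRemT1 d p ι x| ≤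
        nobleMu d p * (1 + ∑' x, |noblePsi d p ι x|) *
          ((2 * d - 1) * (p : ℝ) * i.xiIotaAbs / (1 - nobleMu d p) *
            ((2 * d - 1) * (p : ℝ) * i.xiIotaAbs / (1 - nobleMu d p) *
              ((1 - nobleMu d p ^ 2)⁻¹ * (1 + nobleMu d p))) /
            (1 - (2 * d - 1) * (p : ℝ) * i.xiIotaAbs / (1 - nobleMu d p))) := by
  have h := nobleL1At_of_assumption43 hd hp hp0 h43
  have hμ0 := nobleMu_nonneg d p
  have hA := summable_abs_nobleKer h
  have hrow := nobleKer_row_le h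
  have hu := summable_abs_nobleSeedU (d := d) p
  have hUu := tsum_abs_nobleSeedU_le h
  have hu' : ∀ ι, Summable fun x => |kapply (nobleKer d p) (nobleSeedU d p) ι x| :=
    fun ι => summable_abs_kapply hA hu ι
  have hU' := tsum_abs_kapply_le' hA hu hrow hUu
  have hT2 : (Summable fun x => |nobleSTail2 d p ι x|) ∧ ∑' x, |nobleSTail2 d p ι x| ≤
      (2 * d - 1) * (p : ℝ) * i.xiIotaAbs / (1 - nobleMu d p) *
        ((2 * d - 1) * (p : ℝ) * i.xiIotaAbs / (1 - nobleMu d p) *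
          ((1 - nobleMu d p ^ 2)⁻¹ * (1 + nobleMu d p))) /
        (1 - (2 * d - 1) * (p : ℝ) * i.xiIotaAbs / (1 - nobleMu d p)) :=
    kseries_tail_l1 hA hu' (nobleTheta_nonneg h) (nobleTheta_lt_one h) hrow hU' ι
  have hl := summable_abs_lconv (h.psi ι) hT2.1
  unfold nobleFRemT1
  refine ⟨summable_abs_const_mul' _ (summable_abs_add' hT2.1 hl), ?_⟩
  rw [tsum_abs_const_mul', abs_of_nonneg hμ0, mul_assoc]
  refine mul_le_mul_of_nonneg_left ((tsum_abs_add_le' hT2.1 hl).trans ?_) hμ0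
  have hTl := tsum_abs_lconv_le (h.psi ι) hT2.1
  have hψ0 : 0 ≤ ∑' x, |noblePsi d p ι x| := tsum_nonneg fun _ => abs_nonneg _
  have e := mul_le_mul_of_nonneg_left hT2.2 hψ0
  linarith

/-- **`T2` (`μc(Ψ^ι_{≥2}(x+e_ι) − μΨ^ι_{≥2}(x))`) in `ℓ¹`**: mass `≤ μc(1+μ)(μ̄_p/μ)(β_{Ξ,even tail}+β_{Ξ,odd tail})`.
[cite: FitznerVanDerHofstad2016NoBLE, App. D (D.13) (p. 1113)] -/
theorem nobleFRemT2_l1 (hp0 : 0 < (p : ℝ)) (h43 : NobleAssumption43At d p S i) (ι : Fin d × Bool) :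
    (Summable fun x => |nobleFRemT2 d p ι x|) ∧
      ∑' x, |nobleFRemT2 d p ι x| ≤
        nobleMu d p * (1 - nobleMu d p ^ 2)⁻¹ * (1 + nobleMu d p) *
          ((p : ℝ) / nobleMu d p * (i.xiEvenTail + i.xiOddTail)) := by
  have h := nobleL1At_of_assumption43 hd hp hp0 h43
  have hμ0 := nobleMu_nonneg d p
  have hc0 : 0 ≤ nobleMu d p * (1 - nobleMu d p ^ 2)⁻¹ :=
    mul_nonneg hμ0 (inv_pos.2 (one_sub_mu_sq_pos h)).le
  obtain ⟨hPTs, hPTle⟩ := noblePsiTail2_l1 hd hp h43 ι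
  unfold nobleFRemT2
  refine ⟨summable_abs_const_mul' _ (summable_abs_sub' (summable_abs_comp_add_right hPTs _)
    (summable_abs_const_mul' _ hPTs)), ?_⟩
  have e := tsum_abs_smul_sub_le (nobleMu d p * (1 - nobleMu d p ^ 2)⁻¹) (nobleMu d p)
    (summable_abs_comp_add_right hPTs (𝐞 ι)) hPTs
  rw [tsum_abs_comp_add_right (noblePsiTail2 d p ι) (𝐞 ι), abs_of_nonneg hc0, abs_of_nonneg hμ0] at e
  refine e.trans ?_
  calc nobleMu d p * (1 - nobleMu d p ^ 2)⁻¹ *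
        ((∑' x, |noblePsiTail2 d p ι x|) + nobleMu d p * ∑' x, |noblePsiTail2 d p ι x|)
      ≤ nobleMu d p * (1 - nobleMu d p ^ 2)⁻¹ * ((p : ℝ) / nobleMu d p * (i.xiEvenTail + i.xiOddTail) +
          nobleMu d p * ((p : ℝ) / nobleMu d p * (i.xiEvenTail + i.xiOddTail))) :=
        mul_le_mul_of_nonneg_left (add_le_add hPTle (mul_le_mul_of_nonneg_left hPTle hμ0)) hc0
    _ = nobleMu d p * (1 - nobleMu d p ^ 2)⁻¹ * (1 + nobleMu d p) *
          ((p : ℝ) / nobleMu d p * (i.xiEvenTail + i.xiOddTail)) := by ring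

omit hd hp in
/-- **`T3` (`μc((Ψ^{(0)}_{R,I}−Ψ^{(1)}_{R,I})(x+e_ι) − μ(Ψ^{(0)}_{R,II}−Ψ^{(1)}_{R,II})(x))`) in `ℓ¹`**: mass
`≤ μc((β^{(0)}_{Ψ,R,I}+β^{(1)}_{Ψ,R,I}) + μ(β^{(0)}_{Ψ,R,II}+β^{(1)}_{Ψ,R,II}))`.
[cite: FitznerVanDerHofstad2016NoBLE, App. D (D.13) (p. 1113)] -/
theorem nobleFRemT3_l1 (hd : 2 ≤ d) (hp : p < criticalProbI d) (hp0 : 0 < (p : ℝ))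
    (h43 : NobleAssumption43At d p S i) (ι : Fin d × Bool) :
    (Summable fun x => |nobleFRemT3 S ι x|) ∧
      ∑' x, |nobleFRemT3 S ι x| ≤
        nobleMu d p * (1 - nobleMu d p ^ 2)⁻¹ * ((i.psiRI0 + i.psiRI1) + nobleMu d p * (i.psiRII0 + i.psiRII1)) := by
  have h := nobleL1At_of_assumption43 hd hp hp0 h43
  have hμ0 := nobleMu_nonneg d p
  have hc0 : 0 ≤ nobleMu d p * (1 - nobleMu d p ^ 2)⁻¹ :=
    mul_nonneg hμ0 (inv_pos.2 (one_sub_mu_sq_pos h)).le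
  obtain ⟨hRI0s, hRI0le, hRI1s, hRI1le⟩ := psiRI_l1 h43 ι
  obtain ⟨hRII0s, hRII0le, hRII1s, hRII1le⟩ := psiRII_l1 h43 ι
  have hf3s : Summable fun y => |S.psiRI 0 ι y - S.psiRI 1 ι y| := summable_abs_sub' hRI0s hRI1s
  have hg3s : Summable fun y => |S.psiRII 0 ι y - S.psiRII 1 ι y| := summable_abs_sub' hRII0s hRII1s
  have hf3le : ∑' y, |S.psiRI 0 ι y - S.psiRI 1 ι y| ≤ i.psiRI0 + i.psiRI1 :=
    (tsum_abs_sub_le' hRI0s hRI1s).trans (add_le_add hRI0le hRI1le)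
  have hg3le : ∑' y, |S.psiRII 0 ι y - S.psiRII 1 ι y| ≤ i.psiRII0 + i.psiRII1 :=
    (tsum_abs_sub_le' hRII0s hRII1s).trans (add_le_add hRII0le hRII1le)
  have hf3s' : Summable fun x => |S.psiRI 0 ι (x + 𝐞 ι) - S.psiRI 1 ι (x + 𝐞 ι)| :=
    summable_abs_comp_add_right (a := fun y => S.psiRI 0 ι y - S.psiRI 1 ι y) hf3s (𝐞 ι)
  have heq : ∑' x, |S.psiRI 0 ι (x + 𝐞 ι) - S.psiRI 1 ι (x + 𝐞 ι)| = ∑' y, |S.psiRI 0 ι y - S.psiRI 1 ι y| :=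
    tsum_abs_comp_add_right (fun y => S.psiRI 0 ι y - S.psiRI 1 ι y) (𝐞 ι)
  unfold nobleFRemT3
  refine ⟨summable_abs_const_mul' _ (summable_abs_sub' hf3s' (summable_abs_const_mul' _ hg3s)), ?_⟩
  have e := tsum_abs_smul_sub_le (nobleMu d p * (1 - nobleMu d p ^ 2)⁻¹) (nobleMu d p) hf3s' hg3s
  rw [heq, abs_of_nonneg hc0, abs_of_nonneg hμ0] at e
  exact e.trans (mul_le_mul_of_nonneg_left (add_le_add hf3le (mul_le_mul_of_nonneg_left hg3le hμ0)) hc0)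

/-- **`T4` (`−μc² Σ_κ (Π^{(0),ι,κ}_R − Π^{ι,κ}_{≥1})(x+e_ι+e_κ)`) in `ℓ¹`**: mass
`≤ μc²(Σ_κ Σ_x Π^{(0),ι,κ}_R(x) + (2d−1)μ̄_p(β_{Ξ^ι,odd}+β_{Ξ^ι,even tail}))` (the `Π_R` column kept symbolic:
(4.48) bounds its sum over `ι`, not over `κ`). [cite: FitznerVanDerHofstad2016NoBLE, App. D (D.13) (p. 1113)] -/
theorem nobleFRemT4_l1 (hp0 : 0 < (p : ℝ)) (h43 : NobleAssumption43At d p S i) (ι : Fin d × Bool) :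
    (Summable fun x => |nobleFRemT4 S ι x|) ∧
      ∑' x, |nobleFRemT4 S ι x| ≤
        nobleMu d p * ((1 - nobleMu d p ^ 2)⁻¹) ^ 2 *
          (∑ κ, ∑' x, S.piR ι κ x + (2 * d - 1) * (p : ℝ) * (i.xiIotaOdd + i.xiIotaEvenTail)) := by
  have hμ0 := nobleMu_nonneg d p
  have hC0 : 0 ≤ nobleMu d p * ((1 - nobleMu d p ^ 2)⁻¹) ^ 2 := mul_nonneg hμ0 (sq_nonneg _)
  have hpiR := fun κ => piR_l1 h43 κ
  obtain ⟨hPT1s, hPT1le⟩ := sum_noblePiTail1_l1 hd hp hp0 h43 ι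
  have hκs : ∀ κ, Summable fun x =>
      |S.piR ι κ (x + 𝐞 ι + 𝐞 κ) - noblePiTail1 d p ι κ (x + 𝐞 ι + 𝐞 κ)| := fun κ =>
    summable_abs_sub' (summable_abs_comp_add_right₂ ((hpiR κ).1 ι) _ _)
      (summable_abs_comp_add_right₂ (hPT1s κ) _ _)
  have hgs : Summable fun x => |nobleMu d p * ((1 - nobleMu d p ^ 2)⁻¹) ^ 2 *
      ∑ κ, (S.piR ι κ (x + 𝐞 ι + 𝐞 κ) - noblePiTail1 d p ι κ (x + 𝐞 ι + 𝐞 κ))| :=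
    summable_abs_const_mul' _ (summable_abs_finset_sum' _ fun κ _ => hκs κ)
  have habs : ∀ x, |nobleFRemT4 S ι x| = |nobleMu d p * ((1 - nobleMu d p ^ 2)⁻¹) ^ 2 *
      ∑ κ, (S.piR ι κ (x + 𝐞 ι + 𝐞 κ) - noblePiTail1 d p ι κ (x + 𝐞 ι + 𝐞 κ))| := fun x => by
    unfold nobleFRemT4
    exact abs_neg _
  refine ⟨hgs.congr fun x => (habs x).symm, ?_⟩
  rw [tsum_congr habs, tsum_abs_const_mul', abs_of_nonneg hC0]
  refine mul_le_mul_of_nonneg_left ((tsum_abs_finset_sum_le _ fun κ _ => hκs κ).trans ?_) hC0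
  have hκ : ∀ κ, ∑' x, |S.piR ι κ (x + 𝐞 ι + 𝐞 κ) - noblePiTail1 d p ι κ (x + 𝐞 ι + 𝐞 κ)| ≤
      (∑' x, S.piR ι κ x) + ∑' x, |noblePiTail1 d p ι κ x| := fun κ => by
    have e := tsum_abs_sub_le' (summable_abs_comp_add_right₂ ((hpiR κ).1 ι) (𝐞 ι) (𝐞 κ))
      (summable_abs_comp_add_right₂ (hPT1s κ) (𝐞 ι) (𝐞 κ))
    rw [tsum_abs_comp_add_right₂ (S.piR ι κ) (𝐞 ι) (𝐞 κ),
      tsum_abs_comp_add_right₂ (noblePiTail1 d p ι κ) (𝐞 ι) (𝐞 κ), (hpiR κ).2.1 ι] at e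
    exact e
  calc ∑ κ, ∑' x, |S.piR ι κ (x + 𝐞 ι + 𝐞 κ) - noblePiTail1 d p ι κ (x + 𝐞 ι + 𝐞 κ)|
      ≤ ∑ κ, ((∑' x, S.piR ι κ x) + ∑' x, |noblePiTail1 d p ι κ x|) := Finset.sum_le_sum fun κ _ => hκ κ
    _ = (∑ κ, ∑' x, S.piR ι κ x) + ∑ κ, ∑' x, |noblePiTail1 d p ι κ x| := Finset.sum_add_distrib
    _ ≤ (∑ κ, ∑' x, S.piR ι κ x) + (2 * d - 1) * (p : ℝ) * (i.xiIotaOdd + i.xiIotaEvenTail) :=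
        add_le_add le_rfl hPT1le

/-- **`T5` (`μ²c² Σ_κ (Π^{−ι,κ}(x+e_κ) + Π^{ι,κ}(x+e_ι) − μΠ^{−ι,κ}(x))`) in `ℓ¹`**: mass `≤ μ²c²(2+μ)(2d−1)μ̄_pβ_{Ξ^ι}`.
[cite: FitznerVanDerHofstad2016NoBLE, App. D (D.5), (D.13) (pp. 1111–1113)] -/
theorem nobleFRemT5_l1 (hp0 : 0 < (p : ℝ)) (h43 : NobleAssumption43At d p S i) (ι : Fin d × Bool) :
    (Summable fun x => |nobleFRemT5 d p ι x|) ∧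
      ∑' x, |nobleFRemT5 d p ι x| ≤
        nobleMu d p ^ 2 * ((1 - nobleMu d p ^ 2)⁻¹) ^ 2 *
          ((2 + nobleMu d p) * ((2 * d - 1) * (p : ℝ) * i.xiIotaAbs)) := by
  have h := nobleL1At_of_assumption43 hd hp hp0 h43
  have hμ0 := nobleMu_nonneg d p
  have hC0 : 0 ≤ nobleMu d p ^ 2 * ((1 - nobleMu d p ^ 2)⁻¹) ^ 2 := mul_nonneg (sq_nonneg _) (sq_nonneg _)
  have hκs : ∀ κ, Summable fun x =>
      |noblePi d p (srev ι) κ (x + 𝐞 κ) + noblePi d p ι κ (x + 𝐞 ι) - nobleMu d p * noblePi d p (srev ι) κ x| :=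
    fun κ => summable_abs_sub' (summable_abs_add' (summable_abs_comp_add_right (h.pi (srev ι) κ) _)
      (summable_abs_comp_add_right (h.pi ι κ) _)) (summable_abs_const_mul' _ (h.pi (srev ι) κ))
  have hκle : ∀ κ, ∑' x,
      |noblePi d p (srev ι) κ (x + 𝐞 κ) + noblePi d p ι κ (x + 𝐞 ι) - nobleMu d p * noblePi d p (srev ι) κ x| ≤
      (∑' x, |noblePi d p (srev ι) κ x|) + (∑' x, |noblePi d p ι κ x|) +
        nobleMu d p * ∑' x, |noblePi d p (srev ι) κ x| := fun κ => by
    have e := tsum_abs_sub_le' (summable_abs_add' (summable_abs_comp_add_right (h.pi (srev ι) κ) (𝐞 κ))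
      (summable_abs_comp_add_right (h.pi ι κ) (𝐞 ι))) (summable_abs_const_mul' (nobleMu d p) (h.pi (srev ι) κ))
    have e' := tsum_abs_add_le' (summable_abs_comp_add_right (h.pi (srev ι) κ) (𝐞 κ))
      (summable_abs_comp_add_right (h.pi ι κ) (𝐞 ι))
    rw [tsum_abs_comp_add_right (noblePi d p (srev ι) κ) (𝐞 κ),
      tsum_abs_comp_add_right (noblePi d p ι κ) (𝐞 ι)] at e'
    rw [tsum_abs_const_mul', abs_of_nonneg hμ0] at e
    linarith
  unfold nobleFRemT5
  refine ⟨summable_abs_const_mul' _ (summable_abs_finset_sum' _ fun κ _ => hκs κ), ?_⟩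
  rw [tsum_abs_const_mul', abs_of_nonneg hC0]
  refine mul_le_mul_of_nonneg_left ((tsum_abs_finset_sum_le _ fun κ _ => hκs κ).trans ?_) hC0
  have hs1 : ∑ κ, ∑' x, |noblePi d p (srev ι) κ x| ≤ (2 * d - 1) * (p : ℝ) * i.xiIotaAbs := h.pi_le (srev ι)
  have hs2 : ∑ κ, ∑' x, |noblePi d p ι κ x| ≤ (2 * d - 1) * (p : ℝ) * i.xiIotaAbs := h.pi_le ι
  calc ∑ κ, ∑' x,
        |noblePi d p (srev ι) κ (x + 𝐞 κ) + noblePi d p ι κ (x + 𝐞 ι) - nobleMu d p * noblePi d p (srev ι) κ x|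
      ≤ ∑ κ, ((∑' x, |noblePi d p (srev ι) κ x|) + (∑' x, |noblePi d p ι κ x|) +
          nobleMu d p * ∑' x, |noblePi d p (srev ι) κ x|) := Finset.sum_le_sum fun κ _ => hκle κ
    _ = (1 + nobleMu d p) * (∑ κ, ∑' x, |noblePi d p (srev ι) κ x|) + ∑ κ, ∑' x, |noblePi d p ι κ x| := by
        rw [Finset.sum_add_distrib, Finset.sum_add_distrib, ← Finset.mul_sum]; ring
    _ ≤ (1 + nobleMu d p) * ((2 * d - 1) * (p : ℝ) * i.xiIotaAbs) + (2 * d - 1) * (p : ℝ) * i.xiIotaAbs :=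
        add_le_add (mul_le_mul_of_nonneg_left hs1 (by linarith)) hs2
    _ = (2 + nobleMu d p) * ((2 * d - 1) * (p : ℝ) * i.xiIotaAbs) := by ring

/-- **`T6` (`−μ Ψ^ι ⋆ (Au)_ι`) in `ℓ¹`**: mass `≤ μ ψ₁^ι θU₀` (`‖(Au)_ι‖₁ ≤ θU₀`, row sums of `A` times `‖u‖₁`).
[cite: FitznerVanDerHofstad2016NoBLE, App. D (D.10), (D.13) (pp. 1112–1113)] -/
theorem nobleFRemT6_l1 (hp0 : 0 < (p : ℝ)) (h43 : NobleAssumption43At d p S i) (ι : Fin d × Bool) :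
    (Summable fun x => |nobleFRemT6 d p ι x|) ∧
      ∑' x, |nobleFRemT6 d p ι x| ≤
        nobleMu d p * (∑' x, |noblePsi d p ι x|) *
          ((2 * d - 1) * (p : ℝ) * i.xiIotaAbs / (1 - nobleMu d p) *
            ((1 - nobleMu d p ^ 2)⁻¹ * (1 + nobleMu d p))) := by
  have h := nobleL1At_of_assumption43 hd hp hp0 h43
  have hμ0 := nobleMu_nonneg d p
  have hA := summable_abs_nobleKer h
  have hrow := nobleKer_row_le h
  have hu := summable_abs_nobleSeedU (d := d) p
  have hUu := tsum_abs_nobleSeedU_le h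
  have hU' := tsum_abs_kapply_le' hA hu hrow hUu
  have hAUs := summable_abs_nobleAU h ι
  have hAUle : ∑' x, |nobleAU d p ι x| ≤ (2 * d - 1) * (p : ℝ) * i.xiIotaAbs / (1 - nobleMu d p) *
      ((1 - nobleMu d p ^ 2)⁻¹ * (1 + nobleMu d p)) := by
    rw [← kapply_nobleKer_nobleSeedU_eq h]
    exact hU' ι
  have hl := summable_abs_lconv (h.psi ι) hAUs
  have habs : ∀ x, |nobleFRemT6 d p ι x| = |nobleMu d p * lconv (noblePsi d p ι) (nobleAU d p ι) x| :=
    fun x => by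
      unfold nobleFRemT6
      exact abs_neg _
  refine ⟨(summable_abs_const_mul' _ hl).congr fun x => (habs x).symm, ?_⟩
  rw [tsum_congr habs, tsum_abs_const_mul', abs_of_nonneg hμ0, mul_assoc]
  refine mul_le_mul_of_nonneg_left ((tsum_abs_lconv_le (h.psi ι) hAUs).trans ?_) hμ0
  exact mul_le_mul_of_nonneg_left hAUle (tsum_nonneg fun _ => abs_nonneg _)

/-- **Per-direction remainder `R^F_ι` in `ℓ¹`.** With `c = (1−μ²)⁻¹`, `U₀ = c(1+μ)`, `θ = (2d−1)μ̄_pβ_{Ξ^ι}/(1−μ)`,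
`P = (2d−1)μ̄_pβ_{Ξ^ι}`, `ψ₁^ι = Σ_x|Ψ^ι(x)|`:
`Σ_x |R^F_ι(x)| ≤ μ(1+ψ₁^ι) θ(θU₀)/(1−θ) + μc(1+μ)(μ̄_p/μ)β_{Ξ,≥2} + μc(β_{Ψ,R,I} + μβ_{Ψ,R,II})
 + μc²(Σ_κ Σ_x Π^{(0),ι,κ}_R + (2d−1)μ̄_p β_{Ξ^ι,≥1}) + μ²c²(2+μ)P + μ ψ₁^ι θU₀` (the six terms `T1,…,T6`).
[cite: FitznerVanDerHofstad2016NoBLE, App. D (D.10)–(D.13) (pp. 1112–1113)] -/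
theorem nobleFDirRem_l1 [NeZero d] (hp0 : 0 < (p : ℝ)) (h43 : NobleAssumption43At d p S i) (ι : Fin d × Bool) :
    (Summable fun x => |nobleFDirRem S ι x|) ∧
      ∑' x, |nobleFDirRem S ι x| ≤
        nobleMu d p * (1 + ∑' x, |noblePsi d p ι x|) *
            ((2 * d - 1) * (p : ℝ) * i.xiIotaAbs / (1 - nobleMu d p) *
              ((2 * d - 1) * (p : ℝ) * i.xiIotaAbs / (1 - nobleMu d p) *
                ((1 - nobleMu d p ^ 2)⁻¹ * (1 + nobleMu d p))) /
              (1 - (2 * d - 1) * (p : ℝ) * i.xiIotaAbs / (1 - nobleMu d p))) +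
          nobleMu d p * (1 - nobleMu d p ^ 2)⁻¹ * (1 + nobleMu d p) *
            ((p : ℝ) / nobleMu d p * (i.xiEvenTail + i.xiOddTail)) +
          nobleMu d p * (1 - nobleMu d p ^ 2)⁻¹ * ((i.psiRI0 + i.psiRI1) + nobleMu d p * (i.psiRII0 + i.psiRII1)) +
          nobleMu d p * ((1 - nobleMu d p ^ 2)⁻¹) ^ 2 *
            (∑ κ, ∑' x, S.piR ι κ x + (2 * d - 1) * (p : ℝ) * (i.xiIotaOdd + i.xiIotaEvenTail)) +
          nobleMu d p ^ 2 * ((1 - nobleMu d p ^ 2)⁻¹) ^ 2 *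
            ((2 + nobleMu d p) * ((2 * d - 1) * (p : ℝ) * i.xiIotaAbs)) +
          nobleMu d p * (∑' x, |noblePsi d p ι x|) *
            ((2 * d - 1) * (p : ℝ) * i.xiIotaAbs / (1 - nobleMu d p) *
              ((1 - nobleMu d p ^ 2)⁻¹ * (1 + nobleMu d p))) := by
  obtain ⟨h1s, h1le⟩ := nobleFRemT1_l1 hd hp hp0 h43 ι
  obtain ⟨h2s, h2le⟩ := nobleFRemT2_l1 hd hp hp0 h43 ι
  obtain ⟨h3s, h3le⟩ := nobleFRemT3_l1 hd hp hp0 h43 ι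
  obtain ⟨h4s, h4le⟩ := nobleFRemT4_l1 hd hp hp0 h43 ι
  obtain ⟨h5s, h5le⟩ := nobleFRemT5_l1 hd hp hp0 h43 ι
  obtain ⟨h6s, h6le⟩ := nobleFRemT6_l1 hd hp hp0 h43 ι
  have hrem : ∀ x, nobleFDirRem S ι x = nobleFRemT1 d p ι x + nobleFRemT2 d p ι x + nobleFRemT3 S ι x +
      nobleFRemT4 S ι x + nobleFRemT5 d p ι x + nobleFRemT6 d p ι x := fun x => rfl
  have hs12 := summable_abs_add' h1s h2s
  have hs123 := summable_abs_add' hs12 h3s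
  have hs1234 := summable_abs_add' hs123 h4s
  have hs12345 := summable_abs_add' hs1234 h5s
  have hs := summable_abs_add' hs12345 h6s
  refine ⟨hs.congr fun x => (congrArg abs (hrem x)).symm, ?_⟩
  rw [tsum_congr fun x => congrArg abs (hrem x)]
  have a12 := tsum_abs_add_le' h1s h2s
  have a123 := tsum_abs_add_le' hs12 h3s
  have a1234 := tsum_abs_add_le' hs123 h4s
  have a12345 := tsum_abs_add_le' hs1234 h5s
  have a := tsum_abs_add_le' hs12345 h6s
  linarith

/-- **`R_F ∈ ℓ¹(ℤ^d)` with the explicit bound `nobleFRemBound`** (the per-direction bounds summed over the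
`2d` directions, `Σ_ι ψ₁^ι ≤ Ψ_S = (2d−1)(μ̄_p/μ_p)β_Ξ`, `Σ_ι Σ_κ Σ_x Π^{(0),ι,κ}_R = Σ_κ (Σ_ι …) ≤ 2d β_{Π,R}`), once
`F^α` is totally rotationally symmetric (then `R_F = Σ_ι R^F_ι`).
[cite: FitznerVanDerHofstad2016NoBLE, App. D (D.10)–(D.13) (pp. 1112–1113)] -/
theorem nobleFRem_l1 (hp0 : 0 < (p : ℝ)) (h43 : NobleAssumption43At d p S i) (hT : IsTRS (nobleFAlpha S)) :
    (Summable fun x => |nobleFRem S x|) ∧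
      ∑' x, |nobleFRem S x| ≤ nobleFRemBound d p i ((2 * d - 1) * ((p : ℝ) / nobleMu d p) * i.xiAbs) := by
  haveI : NeZero d := ⟨by omega⟩
  have h := nobleL1At_of_assumption43 hd hp hp0 h43
  have hμ0 := nobleMu_nonneg d p
  have hq := one_sub_mu_sq_pos h
  have hci0 : 0 ≤ (1 - nobleMu d p ^ 2)⁻¹ := (inv_pos.2 hq).le
  have hθ0 := nobleTheta_nonneg h
  have hθ1 := nobleTheta_lt_one h
  have hdir := fun ι => nobleFDirRem_l1 hd hp hp0 h43 ι
  obtain ⟨-, hψle⟩ := noble_sum_psi_l1 hd hp hp0 h43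
  have hrem : ∀ x, nobleFRem S x = ∑ ι, nobleFDirRem S ι x := nobleFRem_eq_sum_dirRem hd hp h h43 hT
  have hs' : Summable fun x => |∑ ι, nobleFDirRem S ι x| := summable_abs_finset_sum' _ fun ι _ => (hdir ι).1
  have hs : Summable fun x => |nobleFRem S x| := hs'.congr fun x => by rw [hrem x]
  refine ⟨hs, ?_⟩
  rw [tsum_congr fun x => congrArg abs (hrem x)]
  have e1 : ∑' x, |∑ ι, nobleFDirRem S ι x| ≤ ∑ ι, ∑' x, |nobleFDirRem S ι x| :=
    tsum_abs_finset_sum_le (Finset.univ : Finset (Fin d × Bool)) fun ι _ => (hdir ι).1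
  -- constants
  set μ : ℝ := nobleMu d p with hμ
  set U0 : ℝ := (1 - μ ^ 2)⁻¹ * (1 + μ) with hU0
  set θ : ℝ := (2 * d - 1) * (p : ℝ) * i.xiIotaAbs / (1 - μ) with hθ
  set Tb : ℝ := θ * (θ * U0) / (1 - θ) with hTb
  set P : ℝ := (2 * d - 1) * (p : ℝ) * i.xiIotaAbs with hP
  set ΨS : ℝ := (2 * d - 1) * ((p : ℝ) / μ) * i.xiAbs with hΨS
  set K : ℝ := μ * Tb + μ * (1 - μ ^ 2)⁻¹ * (1 + μ) * ((p : ℝ) / μ * (i.xiEvenTail + i.xiOddTail)) +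
    μ * (1 - μ ^ 2)⁻¹ * ((i.psiRI0 + i.psiRI1) + μ * (i.psiRII0 + i.psiRII1)) +
    μ * ((1 - μ ^ 2)⁻¹) ^ 2 * ((2 * d - 1) * (p : ℝ) * (i.xiIotaOdd + i.xiIotaEvenTail)) +
    μ ^ 2 * ((1 - μ ^ 2)⁻¹) ^ 2 * ((2 + μ) * P) with hK
  set L : ℝ := μ * (Tb + θ * U0) with hL
  set C : ℝ := μ * ((1 - μ ^ 2)⁻¹) ^ 2 with hC
  have hU00 : 0 ≤ U0 := mul_nonneg hci0 (by linarith)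
  have hTb0 : 0 ≤ Tb := div_nonneg (mul_nonneg hθ0 (mul_nonneg hθ0 hU00)) (by linarith)
  have hL0 : 0 ≤ L := mul_nonneg hμ0 (add_nonneg hTb0 (mul_nonneg hθ0 hU00))
  have hC0 : 0 ≤ C := mul_nonneg hμ0 (sq_nonneg _)
  have e5 : ∑ ι, ∑' x, |nobleFDirRem S ι x| ≤
      ∑ ι : Fin d × Bool, (K + L * (∑' x, |noblePsi d p ι x|) + C * ∑ κ, ∑' x, S.piR ι κ x) :=
    Finset.sum_le_sum fun ι _ => (hdir ι).2.trans (le_of_eq (by simp only [hK, hL, hC, hTb]; ring))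
  have e6 : ∑ ι : Fin d × Bool, (K + L * (∑' x, |noblePsi d p ι x|) + C * ∑ κ, ∑' x, S.piR ι κ x) =
      2 * d * K + L * ∑ ι, ∑' x, |noblePsi d p ι x| + C * ∑ ι, ∑ κ, ∑' x, S.piR ι κ x := by
    rw [Finset.sum_add_distrib, Finset.sum_add_distrib, sum_const_dir, ← Finset.mul_sum, ← Finset.mul_sum]
  have e7 : L * ∑ ι, ∑' x, |noblePsi d p ι x| ≤ L * ΨS := mul_le_mul_of_nonneg_left hψle hL0
  have e8 : ∑ ι, ∑ κ, ∑' x, S.piR ι κ x ≤ 2 * d * i.piR0 := by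
    rw [Finset.sum_comm]
    calc ∑ κ, ∑ ι, ∑' x, S.piR ι κ x ≤ ∑ _κ : Fin d × Bool, i.piR0 :=
          Finset.sum_le_sum fun κ _ => (piR_l1 h43 κ).2.2
      _ = 2 * d * i.piR0 := sum_const_dir d _
  have e9 : C * ∑ ι, ∑ κ, ∑' x, S.piR ι κ x ≤ C * (2 * d * i.piR0) := mul_le_mul_of_nonneg_left e8 hC0
  have goal_eq : nobleFRemBound d p i ΨS = 2 * d * K + L * ΨS + C * (2 * d * i.piR0) := by
    simp only [nobleFRemBound, hK, hL, hC, hTb, hθ, hU0, hP]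
    ring
  rw [goal_eq]
  linarith

omit hp in
/-- **Monotone replacement of App. D Step 1**: the explicit constant is at most `betaRFSq(i)`.
[cite: FitznerVanDerHofstad2016NoBLE, App. D Step 1 and (D.13) (pp. 1110–1113)] -/
theorem nobleFRemBound_le_betaRFSq (hWF : NobleInputsWF d i) (h43 : NobleAssumption43At d p S i) :
    nobleFRemBound d p i ((2 * d - 1) * ((p : ℝ) / nobleMu d p) * i.xiAbs) ≤
      BetaMap.betaRFSq d i.mu i.mub ((2 * d - 1) / (2 * d) * i.mubOverMu) ((2 * d - 1) / (2 * d) * i.mub) i.xiAbs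
        (i.xiEvenTail + i.xiOddTail) i.xiIotaAbs (i.xiIotaOdd + i.xiIotaEvenTail) (i.psiRI0 + i.psiRI1)
        (i.psiRII0 + i.psiRII1) i.piR0 := by
  have hN := hWF.1.toNonneg
  have htmp2 := hWF.1.tmp2_lt_one
  have hm1 := hWF.1.mu_lt_one
  have hX0 : 0 ≤ i.xiIotaAbs := hN.xiIotaAbs
  have hmub : 0 ≤ i.mub := hN.mub
  have htmp : (2 * (d : ℝ) - 1) * i.mub * i.xiIotaAbs / (1 - i.mu) < 1 := by
    have e : 2 * (d : ℝ) * i.mub / (1 - i.mu) * i.xiIotaAbs - (2 * (d : ℝ) - 1) * i.mub * i.xiIotaAbs / (1 - i.mu) =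
        i.mub * i.xiIotaAbs / (1 - i.mu) := by ring
    have e0 : 0 ≤ i.mub * i.xiIotaAbs / (1 - i.mu) := div_nonneg (mul_nonneg hmub hX0) (by linarith)
    linarith
  simp only [nobleFRemBound]
  exact betaRFSq_ge_explicit (Nat.one_le_cast.2 (by omega)) (nobleMu_nonneg d p) h43.mu_le hm1 p.2.1 h43.mub_le
    hN.mubOverMu h43.mubOverMu hN.xiAbs (add_nonneg hN.xiEvenTail hN.xiOddTail) (add_nonneg hN.psiRI0 hN.psiRI1)
    (add_nonneg hN.psiRII0 hN.psiRII1) hN.piR0 hX0 (add_nonneg hN.xiIotaOdd hN.xiIotaEvenTail) htmp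

end FL1

/-! ## Part E. (D.13) as a theorem -/

section D13

local notation "𝐞" => Literature.Probability.Percolation.stepVec

variable {p : unitInterval} {i : BetaMap.Inputs} {S : NobleSplit d p}

variable (hd : 2 ≤ d) (hp : p < criticalProbI d)
include hd hp

/-- **[NoBLE17, App. D (D.13) — theorem, bookkeeping constant].** Under Assumption 4.3 with well-formed constants
`i` (at `0 < p < p_c`) and `F^α` totally rotationally symmetric: `Σ_x |R_F(x)|` converges and is at most
`betaRFSq(i)` (no side condition). [cite: FitznerVanDerHofstad2016NoBLE, App. D Step 2 (D.10)–(D.13) (pp. 1112–1113)] -/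
theorem nobleFRem_l1_le_betaRFSq (hp0 : 0 < (p : ℝ)) (hWF : NobleInputsWF d i) (h43 : NobleAssumption43At d p S i)
    (hT : IsTRS (nobleFAlpha S)) :
    (Summable fun x => |nobleFRem S x|) ∧
      ∑' x, |nobleFRem S x| ≤
        BetaMap.betaRFSq d i.mu i.mub ((2 * d - 1) / (2 * d) * i.mubOverMu) ((2 * d - 1) / (2 * d) * i.mub) i.xiAbs
          (i.xiEvenTail + i.xiOddTail) i.xiIotaAbs (i.xiIotaOdd + i.xiIotaEvenTail) (i.psiRI0 + i.psiRI1)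
          (i.psiRII0 + i.psiRII1) i.piR0 := by
  obtain ⟨hs, hle⟩ := nobleFRem_l1 hd hp hp0 h43 hT
  exact ⟨hs, hle.trans (nobleFRemBound_le_betaRFSq hd hWF h43)⟩

/-- **[NoBLE17, App. D (D.13) — theorem, as wired].** Under the side condition `(2d−1) μ̄ ≤ 2d μ` on the record
(`(2d−1)/(2d)·i.mub ≤ i.mu`): `Σ_x |R_F(x)| ≤ BetaMap.extraOfInputs d i 2 = betaRF(…)`.
[cite: FitznerVanDerHofstad2016NoBLE, App. D Step 2 (D.10)–(D.13) (pp. 1112–1113)] -/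
theorem nobleFRem_l1_le_extraOfInputs (hp0 : 0 < (p : ℝ)) (hWF : NobleInputsWF d i)
    (h43 : NobleAssumption43At d p S i) (hT : IsTRS (nobleFAlpha S)) (hcapQ : (2 * d - 1) * i.mub ≤ 2 * d * i.mu) :
    (Summable fun x => |nobleFRem S x|) ∧ ∑' x, |nobleFRem S x| ≤ BetaMap.extraOfInputs d i 2 := by
  obtain ⟨hs, hle⟩ := nobleFRem_l1_le_betaRFSq hd hp hp0 hWF h43 hT
  have hN := hWF.1.toNonneg
  have hd1 : (1 : ℝ) ≤ d := Nat.one_le_cast.2 (by omega)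
  have hd0 : (0 : ℝ) < 2 * d := by linarith
  have h1 : (2 * d - 1) / (2 * d) * i.mub ≤ i.mu := by
    rw [div_mul_eq_mul_div, div_le_iff₀ hd0]
    linarith
  have h2 : 0 ≤ (2 * (d : ℝ) - 1) / (2 * d) * i.mub :=
    mul_nonneg (div_nonneg (by linarith) hd0.le) hN.mub
  refine ⟨hs, hle.trans ?_⟩
  rw [BetaMap.extraOfInputs_two]
  exact BetaMap.betaRFSq_le_betaRF h1 h2 hN.xiAbs hN.xiIotaAbs

end D13

end Literature.Probability.FitznerVanDerHofstad2017
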